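import Summits.AtomisticToContinuum.FouriersLaw.Theses.CurrentTiltQuench
import Literature.Analysis.FunctionSpaces.WeakCompactnessL1Proofs
import Literature.Analysis.FunctionSpaces.TorusLipschitzFourierH1

/-!
# `CurrentTiltQuench.OddRigidityTransfer` (stmt-AtomisticToContinuum-11035) — proved

`BoundedOddRigidity →` (for every shift-invariant, time-invariant, regular probability measure `ν` of the infinite pinned chain under
which the bond current `j_0` is integrable, `∫ j_0 dν = 0`) — the consequent is `ZeroCurrentRigidity` of the retired route
LocalOhmRigidity (stmt-2739, up to the alias renames). Proof: clip at level `n + 1`, `F_{n+1}(u) = max (-(n+1)) (min (n+1) u)`; each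
clipped mean vanishes by `BoundedOddRigidity`; `F_{n+1}(j_0 σ) → j_0 σ` (eventually constant) with `|F_{n+1}(j_0)| ≤ |j_0| ∈ L¹(ν)`, so
dominated convergence identifies `∫ j_0 dν` as the limit of zeros. Landed by lead c4 of crux stmt-9127. No definitions.
-/

namespace Summit.AtomisticToContinuum.FouriersLaw.Theorems.CurrentTiltQuench

open MeasureTheory Filter Topology
open Summit.AtomisticToContinuum.FouriersLaw.Theses.CurrentTiltQuench
open Literature.Analysis.FunctionSpaces (max_neg_min_eq_self abs_clamp_le_abs)

/-- **`OddRigidityTransfer` (stmt-AtomisticToContinuum-11035).** `BoundedOddRigidity` implies zero mean bond current in every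
shift-invariant, time-invariant, regular probability measure of the infinite pinned chain under which `j_0` is integrable (dominated
convergence along the clips at levels `n + 1`). [folklore] -/
theorem oddRigidityTransfer_proof :
    Summit.AtomisticToContinuum.FouriersLaw.Theses.CurrentTiltQuench.OddRigidityTransfer := by
  intro hB ω₂ lam β γ hω hl hβ ν hprob hS hT hR hint
  set P := Literature.MathematicalPhysics.KineticTheory.HeatConduction.pinnedChain ω₂ lam β γ with hP
  -- the clipped means vanish
  have hclip : ∀ n : ℕ, ∫ σ, max (-((n : ℝ) + 1)) (min ((n : ℝ) + 1) (P.bondCurrentZ σ 0)) ∂ν = 0 :=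
    fun n => hB ω₂ lam β γ hω hl hβ ν hprob hS hT hR ((n : ℝ) + 1) (by positivity)
  -- dominated convergence: the clipped integrals tend to `∫ j_0 dν`
  have hlim : Tendsto (fun n : ℕ => ∫ σ, max (-((n : ℝ) + 1)) (min ((n : ℝ) + 1) (P.bondCurrentZ σ 0)) ∂ν) atTop
      (𝓝 (∫ σ, P.bondCurrentZ σ 0 ∂ν)) := by
    refine tendsto_integral_of_dominated_convergence (fun σ => |P.bondCurrentZ σ 0|) (fun n => ?_) hint.abs
      (fun n => ae_of_all _ fun σ => ?_) (ae_of_all _ fun σ => ?_)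
    · exact ((measurable_const.max (measurable_const.min
        (Literature.MathematicalPhysics.KineticTheory.HeatConduction.measurable_bondCurrentZ P 0)))).aestronglyMeasurable
    · rw [Real.norm_eq_abs]
      exact abs_clamp_le_abs (by positivity) _
    · refine tendsto_const_nhds.congr' ?_
      obtain ⟨N, hN⟩ := exists_nat_ge |P.bondCurrentZ σ 0|
      filter_upwards [eventually_ge_atTop N] with n hn
      refine (max_neg_min_eq_self ?_).symm
      have : (N : ℝ) ≤ n := by exact_mod_cast hn
      linarith
  have hzero : Tendsto (fun n : ℕ => ∫ σ, max (-((n : ℝ) + 1)) (min ((n : ℝ) + 1) (P.bondCurrentZ σ 0)) ∂ν) atTop (𝓝 0) := by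
    simp_rw [hclip]
    exact tendsto_const_nhds
  exact tendsto_nhds_unique hlim hzero

end Summit.AtomisticToContinuum.FouriersLaw.Theorems.CurrentTiltQuench
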